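import Literature.RepresentationTheory.FiniteGroups.GLnTransposeInvolution
import Literature.RepresentationTheory.FiniteGroups.GLnBruhat
import Literature.RepresentationTheory.FiniteGroups.HeckeMultiplicityOne
import Mathlib.NumberTheory.LegendreSymbol.AddCharacter
import HarnessLib

/-!
# The Gelfand–Graev representation of `GL_n(𝔽_q)` is multiplicity-free
# (uniqueness of Whittaker models)

Topic `Literature/RepresentationTheory/FiniteGroups`.  (Gelfand–Graev 1962; Steinberg, *Lectures on
Chevalley Groups*, Thm. 49; Carter, *Finite Groups of Lie Type*, Thm. 8.1.3; Bump, *Automorphic Forms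
and Representations*, Thm. 4.1.2 for `n = 2`.)  Let `U = U_n` be the upper unitriangular group and
`ψ_U(u) = ψ₀(∑ u_{i,i+1})` (`GLn.theta ψ₀ 1`) for a non-trivial additive character `ψ₀` of the finite
field `F`.  Then the Hecke algebra `ℋ(GL_n(F), U, ψ_U)` is commutative (`conv_comm_unitUpper`), hence
(Gelfand's lemma, `finrank_weightSpace_le_one_of_conv_comm`) every irreducible representation of
`GL_n(F)` has at most a line of Whittaker vectors (`finrank_whittaker_le_one`).

Proof (Gelfand's trick with `ι(g) = J gᵀ J`): a Hecke function `f` with `f(m) ≠ 0` at a monomial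
matrix `m = (σ, d)` forces, testing with the root elements `1 + a E_{k,k+1}`
(`relevant_of_apply_ne_zero`), `σ(k+1) < σ(k)` or (`σ(k+1) = σ(k) + 1` and `d_k = d_{k+1}`); a
combinatorial lemma on such permutations (`involutive_of_steps`: `v = rev ∘ σ` reverses each maximal
run of `-1`-steps in place) gives `ι(m) = m`; with the Bruhat decomposition `g = u₁ m u₂`
(`exists_bruhat`) this yields `f ∘ ι = f` for every Hecke function, and `conv_comm_of_antiInvolution`
concludes.  Everything here is a theorem.

## References

* I. M. Gelfand, M. I. Graev, Dokl. Akad. Nauk SSSR 147 (1962); R. Steinberg, *Lectures on Chevalley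
  Groups*, §14 Thm. 49; R. W. Carter, *Finite Groups of Lie Type*, §8.1; D. Bump, *Automorphic Forms
  and Representations*, Thm. 4.1.2.
-/

noncomputable section

open scoped BigOperators Matrix
open Module

namespace Literature.RepresentationTheory.FiniteGroups.GLn

/-! ### A combinatorial lemma: permutations whose descents are unit steps -/

section Comb

variable {X : Type*} {n : ℕ} {V : ℕ → ℕ} {D : ℕ → X}

/-- Values along a run `[a, b]` of `-1` steps: `V l = V a - (l - a)`. [folklore] -/
theorem run_val {a b : ℕ} (hrun : ∀ l, a ≤ l → l < b → V l = V (l + 1) + 1) :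
    ∀ l, a ≤ l → l ≤ b → V l + (l - a) = V a := by
  intro l hal hlb
  induction l, hal using Nat.le_induction with
  | base => simp
  | succ l hal ih =>
    have := hrun l hal (by omega)
    have := ih (by omega)
    omega

/-- `D` is constant along a run of `-1` steps. [folklore] -/
theorem run_D (hstep : ∀ i, i + 1 < n → V i < V (i + 1) ∨ (V i = V (i + 1) + 1 ∧ D i = D (i + 1)))
    {a b : ℕ} (hrun : ∀ l, a ≤ l → l < b → V l = V (l + 1) + 1) (hb : b < n) :
    ∀ l, a ≤ l → l ≤ b → D l = D a := by
  intro l hal hlb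
  induction l, hal using Nat.le_induction with
  | base => rfl
  | succ l hal ih =>
    have h1 := hrun l hal (by omega)
    rcases hstep l (by omega) with h2 | h2
    · omega
    · rw [← h2.2, ih (by omega)]

/-- **The run lemma**: for an injective `V : [0,n) → [0,n)` all of whose descents are `-1` steps, a
maximal run `[a, b]` of `-1` steps preceded by a `V`-stable prefix `[0, a)` ends at the value `V b = a`
(walk back from the position of the value `a`). [folklore] -/
theorem run_end (hlt : ∀ i, i < n → V i < n) (hinj : ∀ i j, i < n → j < n → V i = V j → i = j)
    (hsurj : ∀ y, y < n → ∃ i, i < n ∧ V i = y)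
    (hstep : ∀ i, i + 1 < n → V i < V (i + 1) ∨ (V i = V (i + 1) + 1 ∧ D i = D (i + 1)))
    {a b : ℕ} (hab : a ≤ b) (hb : b < n)
    (hrun : ∀ l, a ≤ l → l < b → V l = V (l + 1) + 1)
    (hmax : ¬(b + 1 < n ∧ V b = V (b + 1) + 1))
    (hpre : ∀ i, i < n → (i < a ↔ V i < a)) : V b = a := by
  by_contra hne
  have hge : ∀ i, a ≤ i → i < n → a ≤ V i := fun i hai hin => by
    by_contra hlt'; push Not at hlt'
    have := (hpre i hin).mpr hlt'; omega
  have hVb : a < V b := lt_of_le_of_ne (hge b hab hb) (Ne.symm hne)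
  have hvals := run_val hrun
  obtain ⟨p, hpn, hpa⟩ := hsurj a (by have := hlt b hb; omega)
  have hpa' : a ≤ p := by
    by_contra hlt'; push Not at hlt'
    have := (hpre p hpn).mp hlt'; omega
  have hpb : b < p := by
    by_contra hle; push Not at hle
    have := hvals p hpa' hle
    have := hvals b hab le_rfl
    omega
  -- walk back from `p`: `V (p - k) = a + k`
  have walk : ∀ k, k ≤ p - b - 1 → ∀ k', k' ≤ k → V (p - k') = a + k' := by
    intro k hk
    induction k with
    | zero =>
      intro k' hk'
      have hk0 : k' = 0 := by omega
      rw [hk0, Nat.sub_zero, Nat.add_zero]; exact hpa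
    | succ k ih =>
      have ih' := ih (by omega)
      intro k' hk'
      rcases Nat.lt_or_ge k' (k + 1) with hlt' | hge'
      · exact ih' k' (by omega)
      · obtain rfl : k' = k + 1 := by omega
        set q := p - (k + 1) with hq
        have hqn : q < n := by omega
        have hqa : a ≤ V q := hge q (by omega) hqn
        have hbig : a + k + 1 ≤ V q := by
          by_contra hsmall; push Not at hsmall
          have hk'' : V q - a ≤ k := by omega
          have h1 := ih' (V q - a) hk''
          have h2 : q = p - (V q - a) := hinj q (p - (V q - a)) hqn (by omega) (by rw [h1]; omega)
          omega
        have hst := hstep q (by omega)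
        have hq1 : q + 1 = p - k := by omega
        rw [hq1, ih' k le_rfl] at hst
        rcases hst with hs | hs
        · omega
        · omega
  have hwalk := walk (p - b - 1) le_rfl
  have hb1 : V (b + 1) = a + (p - b - 1) := by
    have := hwalk (p - b - 1) le_rfl
    rwa [show p - (p - b - 1) = b + 1 by omega] at this
  have hbig : a + (p - b) ≤ V b := by
    by_contra hsmall; push Not at hsmall
    have hk'' : V b - a ≤ p - b - 1 := by omega
    have h1 := hwalk (V b - a) hk''
    have h2 : b = p - (V b - a) := hinj b (p - (V b - a)) hb (by omega) (by rw [h1]; omega)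
    omega
  rcases hstep b (by omega) with hs | hs
  · omega
  · exact hmax ⟨by omega, hs.1⟩

/-- Propagation of the prefix invariant across a reversed run. [folklore] -/
theorem prefix_extend (hinj : ∀ i j, i < n → j < n → V i = V j → i = j) {a b : ℕ} (hab : a ≤ b)
    (hrun : ∀ l, a ≤ l → l < b → V l = V (l + 1) + 1) (hVb : V b = a)
    (hpre : ∀ i, i < n → (i < a ↔ V i < a)) : ∀ i, i < n → (i < b + 1 ↔ V i < b + 1) := by
  have hvals := run_val hrun
  have hin : ∀ l, a ≤ l → l ≤ b → V l = a + b - l := fun l h1 h2 => by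
    have := hvals l h1 h2; have := hvals b hab le_rfl; omega
  intro i hi
  constructor
  · intro hib
    rcases Nat.lt_or_ge i a with hia | hia
    · have := (hpre i hi).mp hia; omega
    · rw [hin i hia (by omega)]; omega
  · intro hVi
    by_contra hib; push Not at hib
    have hVia : a ≤ V i := by
      by_contra hlt'; push Not at hlt'
      have := (hpre i hi).mpr hlt'; omega
    set l := a + b - V i with hl
    have hVl : V l = V i := by rw [hin l (by omega) (by omega)]; omega
    have := hinj l i (by omega) hi hVl
    omega

/-- **Structure theorem**: every position lies in a maximal run `[a, b]` which `V` reverses in place: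
`V l = a + b - l` on `[a, b]`. [folklore] -/
theorem exists_run (hlt : ∀ i, i < n → V i < n) (hinj : ∀ i j, i < n → j < n → V i = V j → i = j)
    (hsurj : ∀ y, y < n → ∃ i, i < n ∧ V i = y)
    (hstep : ∀ i, i + 1 < n → V i < V (i + 1) ∨ (V i = V (i + 1) + 1 ∧ D i = D (i + 1))) :
    ∀ j, j < n → ∃ a b, a ≤ j ∧ j ≤ b ∧ b < n ∧ (∀ l, a ≤ l → l < b → V l = V (l + 1) + 1) ∧
      (∀ l, a ≤ l → l ≤ b → V l = a + b - l) := by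
  classical
  -- the prefix invariant at every run boundary, by strong induction
  have claim : ∀ a, a ≤ n → (a = 0 ∨ ¬(V (a - 1) = V a + 1)) → ∀ i, i < n → (i < a ↔ V i < a) := by
    intro a
    induction a using Nat.strong_induction_on with
    | _ a ih =>
      intro han hbd i hi
      rcases hbd with rfl | hbd
      · simp
      · rcases Nat.eq_zero_or_pos a with rfl | hapos
        · simp
        · have hex : ∃ a', a' ≤ a - 1 ∧ ∀ l, a' ≤ l → l < a - 1 → V l = V (l + 1) + 1 :=
            ⟨a - 1, le_rfl, fun l h1 h2 => by omega⟩
          have ha' := Nat.find_spec hex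
          have hmin : ∀ a'', a'' < Nat.find hex →
              ¬(a'' ≤ a - 1 ∧ ∀ l, a'' ≤ l → l < a - 1 → V l = V (l + 1) + 1) :=
            fun a'' h'' => Nat.find_min hex h''
          set a' := Nat.find hex with ha'def
          have hbd' : a' = 0 ∨ ¬(V (a' - 1) = V a' + 1) := by
            rcases Nat.eq_zero_or_pos a' with h0 | hpos
            · exact Or.inl h0
            · right
              intro hst
              apply hmin (a' - 1) (by omega)
              refine ⟨by omega, fun l h1 h2 => ?_⟩
              rcases Nat.lt_or_ge l a' with hl | hl
              · obtain rfl : l = a' - 1 := by omega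
                rw [show a' - 1 + 1 = a' by omega]; exact hst
              · exact ha'.2 l hl h2
          have hpre' := ih a' (by omega) (by omega) hbd'
          have hVend : V (a - 1) = a' :=
            run_end hlt hinj hsurj hstep ha'.1 (by omega) ha'.2
              (fun ⟨_, h2⟩ => hbd (by rw [show a - 1 + 1 = a by omega] at h2; exact h2)) hpre'
          have := prefix_extend hinj ha'.1 ha'.2 hVend hpre' i hi
          rwa [show a - 1 + 1 = a by omega] at this
  intro j hj
  -- the run end `b`
  have hexb : ∃ b, j ≤ b ∧ ¬(b + 1 < n ∧ V b = V (b + 1) + 1) := ⟨n - 1, by omega, fun ⟨h1, _⟩ => by omega⟩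
  have hb := Nat.find_spec hexb
  have hbmin : ∀ b', b' < Nat.find hexb → ¬(j ≤ b' ∧ ¬(b' + 1 < n ∧ V b' = V (b' + 1) + 1)) :=
    fun b' h' => Nat.find_min hexb h'
  set b := Nat.find hexb with hbdef
  have hbn : b < n := by
    by_contra hge; push Not at hge
    exact hbmin (n - 1) (by omega) ⟨by omega, fun ⟨h1, _⟩ => by omega⟩
  have hrunb : ∀ l, j ≤ l → l < b → V l = V (l + 1) + 1 := fun l h1 h2 => by
    by_contra hst
    exact hbmin l h2 ⟨h1, fun ⟨_, h⟩ => hst h⟩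
  -- the run start `a`
  have hexa : ∃ a, a ≤ j ∧ ∀ l, a ≤ l → l < j → V l = V (l + 1) + 1 := ⟨j, le_rfl, fun l h1 h2 => by omega⟩
  have ha := Nat.find_spec hexa
  have hamin : ∀ a'', a'' < Nat.find hexa → ¬(a'' ≤ j ∧ ∀ l, a'' ≤ l → l < j → V l = V (l + 1) + 1) :=
    fun a'' h'' => Nat.find_min hexa h''
  set a := Nat.find hexa with hadef
  have hbd : a = 0 ∨ ¬(V (a - 1) = V a + 1) := by
    rcases Nat.eq_zero_or_pos a with h0 | hpos
    · exact Or.inl h0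
    · right; intro hst
      apply hamin (a - 1) (by omega)
      refine ⟨by omega, fun l h1 h2 => ?_⟩
      rcases Nat.lt_or_ge l a with hl | hl
      · obtain rfl : l = a - 1 := by omega
        rw [show a - 1 + 1 = a by omega]; exact hst
      · exact ha.2 l hl h2
  have hrun : ∀ l, a ≤ l → l < b → V l = V (l + 1) + 1 := fun l h1 h2 => by
    rcases Nat.lt_or_ge l j with hl | hl
    · exact ha.2 l h1 hl
    · exact hrunb l hl h2
  have hpre := claim a (by omega) hbd
  have hVb : V b = a := run_end hlt hinj hsurj hstep (by omega) hbn hrun hb.2 hpre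
  have hvals := run_val hrun
  refine ⟨a, b, ha.1, hb.1, hbn, hrun, fun l h1 h2 => ?_⟩
  have := hvals l h1 h2
  have := hvals b (by omega) le_rfl
  omega

/-- **The involution lemma**: `V (V j) = j` and `D (V j) = D j`. [folklore] -/
theorem involutive_of_steps (hlt : ∀ i, i < n → V i < n) (hinj : ∀ i j, i < n → j < n → V i = V j → i = j)
    (hsurj : ∀ y, y < n → ∃ i, i < n ∧ V i = y)
    (hstep : ∀ i, i + 1 < n → V i < V (i + 1) ∨ (V i = V (i + 1) + 1 ∧ D i = D (i + 1))) :
    ∀ j, j < n → V (V j) = j ∧ D (V j) = D j := by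
  intro j hj
  obtain ⟨a, b, haj, hjb, hbn, hrun, hin⟩ := exists_run hlt hinj hsurj hstep j hj
  have hVj : V j = a + b - j := hin j haj hjb
  constructor
  · rw [hVj, hin (a + b - j) (by omega) (by omega)]; omega
  · have hD := run_D hstep hrun hbn
    rw [hD j haj hjb, hVj, hD (a + b - j) (by omega) (by omega)]

/-- The involution lemma for permutations of `Fin n`. [folklore] -/
theorem perm_involutive_of_steps {Y : Type*} (v : Equiv.Perm (Fin n)) (d : Fin n → Y)
    (hstep : ∀ (k : Fin n) (hk : k.val + 1 < n),
      v k < v ⟨k.val + 1, hk⟩ ∨ ((v k).val = (v ⟨k.val + 1, hk⟩).val + 1 ∧ d k = d ⟨k.val + 1, hk⟩)) :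
    ∀ j, v (v j) = j ∧ d (v j) = d j := by
  rcases Nat.eq_zero_or_pos n with hn | hn
  · subst hn; intro j; exact j.elim0
  let j₀ : Fin n := ⟨0, hn⟩
  let V : ℕ → ℕ := fun i => if h : i < n then (v ⟨i, h⟩).val else i
  let D : ℕ → Y := fun i => if h : i < n then d ⟨i, h⟩ else d j₀
  have hV : ∀ (i : ℕ) (h : i < n), V i = (v ⟨i, h⟩).val := fun i h => by simp [V, h]
  have hD : ∀ (i : ℕ) (h : i < n), D i = d ⟨i, h⟩ := fun i h => by simp [D, h]
  have hlt : ∀ i, i < n → V i < n := fun i h => by rw [hV i h]; exact (v _).2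
  have hinj : ∀ i j, i < n → j < n → V i = V j → i = j := fun i j hi hj h => by
    rw [hV i hi, hV j hj] at h
    have := v.injective (Fin.ext h)
    simpa using this
  have hsurj : ∀ y, y < n → ∃ i, i < n ∧ V i = y := fun y hy =>
    ⟨(v.symm ⟨y, hy⟩).val, (v.symm _).2, by rw [hV _ (v.symm _).2]; simp⟩
  have hstep' : ∀ i, i + 1 < n → V i < V (i + 1) ∨ (V i = V (i + 1) + 1 ∧ D i = D (i + 1)) := by
    intro i hi
    rw [hV i (by omega), hV (i + 1) hi, hD i (by omega), hD (i + 1) hi]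
    exact hstep ⟨i, by omega⟩ hi
  intro j
  obtain ⟨h1, h2⟩ := involutive_of_steps hlt hinj hsurj hstep' j.val j.2
  rw [hV j.val j.2, Fin.eta, hV _ (v j).2, Fin.eta] at h1
  rw [hV j.val j.2, Fin.eta, hD _ (v j).2, hD _ j.2, Fin.eta, Fin.eta] at h2
  exact ⟨Fin.ext h1, h2⟩

end Comb

/-! ### Monomial matrices, root elements, and the character `ψ_U` -/

section Monomial

variable {F : Type} [Field F] {n : ℕ}

/-- The scalars of an invertible monomial matrix are non-zero. [folklore] -/
theorem monomial_ne_zero {m : GL (Fin n) F} {σ : Equiv.Perm (Fin n)} {d : Fin n → F}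
    (hm : ∀ i j, m.val i j = if i = σ j then d j else 0) (j : Fin n) : d j ≠ 0 := by
  intro h0
  exact Matrix.GeneralLinearGroup.det_ne_zero m
    (Matrix.det_eq_zero_of_column_eq_zero j fun i => by rw [hm]; split_ifs <;> simp [h0])

/-- The inverse of a monomial matrix: `(m⁻¹)_{ab} = [b = σ a] d_a⁻¹`. [folklore] -/
theorem monomial_inv_apply {m : GL (Fin n) F} {σ : Equiv.Perm (Fin n)} {d : Fin n → F}
    (hm : ∀ i j, m.val i j = if i = σ j then d j else 0) (a b : Fin n) :
    (m⁻¹).val a b = if b = σ a then (d a)⁻¹ else 0 := by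
  set N : Matrix (Fin n) (Fin n) F := Matrix.of fun a b => if b = σ a then (d a)⁻¹ else 0 with hN
  have hmN : m.val * N = 1 := by
    ext i j
    rw [Matrix.mul_apply, Finset.sum_eq_single (σ.symm i)]
    · rw [hm, hN, Matrix.of_apply, Equiv.apply_symm_apply, if_pos rfl, Matrix.one_apply]
      by_cases hij : i = j
      · subst hij; rw [if_pos rfl, mul_inv_cancel₀ (monomial_ne_zero hm _), if_pos rfl]
      · rw [if_neg (Ne.symm hij), mul_zero, if_neg hij]
    · intro l _ hl
      rw [hm, if_neg, zero_mul]
      intro h; apply hl; rw [h, Equiv.symm_apply_apply]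
    · simp
  have : (m⁻¹).val = N := by
    rw [Matrix.coe_units_inv]
    exact Matrix.inv_eq_right_inv hmN
  rw [this, hN, Matrix.of_apply]

/-- The root element `x_{ij}(c) = 1 + c E_{ij}` (`i < j`) is upper unitriangular. [folklore] -/
theorem isUnitUpper_one_add_single {i j : Fin n} (hij : i < j) (c : F) :
    IsUnitUpper F n (1 + Matrix.single i j c) := by
  refine ⟨fun a b hab => ?_, fun a => ?_⟩
  · rw [Matrix.add_apply, Matrix.one_apply_ne (ne_of_gt hab), Matrix.single_apply, if_neg, add_zero]
    rintro ⟨rfl, rfl⟩; exact lt_asymm hij hab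
  · rw [Matrix.add_apply, Matrix.one_apply_eq, Matrix.single_apply, if_neg, add_zero]
    rintro ⟨rfl, rfl⟩; exact lt_irrefl _ hij

/-- `ψ_U(1 + c E_{ij}) = ψ₀(c [j = i + 1])`. [folklore] -/
theorem theta_one_add_single (ψ₀ : AddChar F ℂ) {i j : Fin n} (hij : i < j) (c : F) :
    theta ψ₀ 1 (unitUpperMk F n _ (isUnitUpper_one_add_single hij c)) =
      ψ₀ (if j.val = i.val + 1 then c else 0) := by
  rw [theta, coe_unitUpperMk, superdiagSum_one_eq_sum_sum]
  congr 1
  have h : ∀ a b : Fin n, (if b.val = a.val + 1 then (1 + Matrix.single i j c) a b else 0) =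
      if a = i then (if b = j then (if j.val = i.val + 1 then c else 0) else 0) else 0 := by
    intro a b
    by_cases hab : b.val = a.val + 1
    · rw [if_pos hab, Matrix.add_apply, Matrix.one_apply_ne (fun e => by rw [e] at hab; omega), zero_add,
        Matrix.single_apply]
      by_cases ha : a = i
      · subst ha
        by_cases hb : b = j
        · subst hb; rw [if_pos ⟨rfl, rfl⟩, if_pos rfl, if_pos rfl, if_pos hab]
        · rw [if_neg (fun h => hb h.2.symm), if_pos rfl, if_neg hb]
      · rw [if_neg (fun h => ha h.1.symm), if_neg ha]
    · rw [if_neg hab]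
      by_cases ha : a = i
      · subst ha
        by_cases hb : b = j
        · subst hb; rw [if_pos rfl, if_pos rfl, if_neg (fun h => hab h)]
        · rw [if_pos rfl, if_neg hb]
      · rw [if_neg ha]
  simp only [h]
  rw [Finset.sum_eq_single i, Finset.sum_eq_single j]
  · rw [if_pos rfl, if_pos rfl]
  · intro b _ hb; rw [if_pos rfl, if_neg hb]
  · simp
  · intro a _ ha; exact Finset.sum_eq_zero fun b _ => by rw [if_neg ha]
  · simp

/-- **Conjugating a root element by a monomial matrix**: `m (1 + a E_{k k'}) m⁻¹ = 1 + (a d_k/d_{k'}) E_{σ k, σ k'}`.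
[folklore] -/
theorem monomial_conj_single {m : GL (Fin n) F} {σ : Equiv.Perm (Fin n)} {d : Fin n → F}
    (hm : ∀ i j, m.val i j = if i = σ j then d j else 0) (k k' : Fin n) (a : F) :
    m.val * (1 + Matrix.single k k' a) * (m⁻¹).val = 1 + Matrix.single (σ k) (σ k') (d k * a * (d k')⁻¹) := by
  rw [mul_add, mul_one, add_mul, ← Units.val_mul, mul_inv_cancel, Units.val_one]
  congr 1
  ext i j
  rw [Matrix.mul_apply, Finset.sum_eq_single k']
  · rw [Matrix.mul_apply, Finset.sum_eq_single k]
    · rw [hm, monomial_inv_apply hm, Matrix.single_apply_same, Matrix.single_apply]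
      by_cases h1 : i = σ k
      · by_cases h2 : j = σ k'
        · rw [if_pos h1, if_pos h2, if_pos ⟨h1.symm, h2.symm⟩]
        · rw [if_neg h2, mul_zero, if_neg (fun h => h2 h.2.symm)]
      · rw [if_neg h1, zero_mul, zero_mul, if_neg (fun h => h1 h.1.symm)]
    · intro l _ hl
      rw [Matrix.single_apply, if_neg (fun h => hl h.1.symm), mul_zero]
    · simp
  · intro l _ hl
    rw [Matrix.mul_apply]
    rw [Finset.sum_eq_zero, zero_mul]
    intro l' _
    rw [Matrix.single_apply, if_neg (fun h => hl h.2.symm), mul_zero]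
  · simp

end Monomial

/-! ### Relevant monomial matrices are `ι`-fixed -/

section Relevant

variable {F : Type} [Field F] [Fintype F] [DecidableEq F] {n : ℕ} (ψ₀ : AddChar F ℂ)

omit [Fintype F] in
/-- A non-trivial additive character of a field takes a value `≠ 1` on every non-zero multiple:
if `ψ₀(c a) = ψ₀(a)` for all `a` then `c = 1`. [folklore] -/
theorem eq_one_of_forall_apply_mul_eq (hψ₀ : ψ₀ ≠ 1) {c : F} (h : ∀ a : F, ψ₀ a = ψ₀ (c * a)) : c = 1 := by
  by_contra hc
  obtain ⟨x, hx⟩ := AddChar.ne_one_iff.mp hψ₀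
  have h1c : (1 - c) ≠ 0 := sub_ne_zero.mpr (Ne.symm hc)
  set a := x / (1 - c) with ha
  have hxa : x = a + -(c * a) := by rw [ha]; field_simp; ring
  apply hx
  have h1 := h a
  have h2 : ψ₀ (c * a) * ψ₀ (-(c * a)) = 1 := by rw [← AddChar.map_add_eq_mul, add_neg_cancel, AddChar.map_zero_eq_one]
  rw [hxa, AddChar.map_add_eq_mul, h1, h2]

omit [Fintype F] in
/-- **Relevance**: if a `(U, ψ_U)`-Hecke function does not vanish at the monomial matrix `(σ, d)`, then
for each `k`: `σ(k+1) < σ(k)`, or `σ(k+1) = σ(k) + 1` and `d_k = d_{k+1}` (test with the root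
elements `1 + a E_{k,k+1}`; Carter §8.1, Steinberg Thm. 49). [folklore] -/
theorem relevant_of_apply_ne_zero (hψ₀ : ψ₀ ≠ 1) {f : GL (Fin n) F → ℂ}
    (hf : IsHeckeFunction (unitUpper F n) (thetaHom ψ₀ 1 (unitUpper F n) le_rfl) f)
    {m : GL (Fin n) F} {σ : Equiv.Perm (Fin n)} {d : Fin n → F}
    (hm : ∀ i j, m.val i j = if i = σ j then d j else 0) (hfm : f m ≠ 0) (k : Fin n) (hk : k.val + 1 < n) :
    σ ⟨k.val + 1, hk⟩ < σ k ∨ ((σ ⟨k.val + 1, hk⟩).val = (σ k).val + 1 ∧ d k = d ⟨k.val + 1, hk⟩) := by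
  set k1 : Fin n := ⟨k.val + 1, hk⟩ with hk1
  have hkk1 : k < k1 := by rw [Fin.lt_def]; simp [hk1]
  rcases lt_trichotomy (σ k1) (σ k) with hlt | heq | hgt
  · exact Or.inl hlt
  · exfalso
    have := σ.injective heq
    rw [Fin.ext_iff] at this; simp [hk1] at this
  · right
    -- test with `T_a = 1 + a E_{k,k1}`; `m T_a m⁻¹ = 1 + (d_k a / d_{k1}) E_{σ k, σ k1} ∈ U`
    have key : ∀ a : F, ψ₀ a = ψ₀ (if (σ k1).val = (σ k).val + 1 then d k * a * (d k1)⁻¹ else 0) := by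
      intro a
      set T := unitUpperMk F n _ (isUnitUpper_one_add_single hkk1 a) with hT
      set T' := unitUpperMk F n _ (isUnitUpper_one_add_single hgt (d k * a * (d k1)⁻¹)) with hT'
      have hconj : m * T * m⁻¹ = T' := by
        apply Units.ext
        rw [Units.val_mul, Units.val_mul, hT, hT', coe_unitUpperMk, coe_unitUpperMk]
        exact monomial_conj_single hm k k1 a
      have hmT : m * T = T' * m := by rw [← hconj]; group
      have h1 := (hf ⟨T, unitUpperMk_mem F n _ _⟩ m).2
      have h2 := (hf ⟨T', unitUpperMk_mem F n _ _⟩ m).1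
      simp only [coe_thetaHom_apply] at h1 h2
      rw [hmT] at h1
      rw [h1, hT, theta_one_add_single ψ₀ hkk1 a, hT', theta_one_add_single ψ₀ hgt (d k * a * (d k1)⁻¹),
        if_pos (by simp [hk1] : k1.val = k.val + 1), mul_comm] at h2
      exact mul_right_cancel₀ hfm h2
    by_cases hP : (σ k1).val = (σ k).val + 1
    · refine ⟨hP, ?_⟩
      simp only [if_pos hP] at key
      have hc : d k * (d k1)⁻¹ = 1 :=
        eq_one_of_forall_apply_mul_eq ψ₀ hψ₀ fun a => by rw [key a]; congr 1; ring
      have hk1ne := monomial_ne_zero hm k1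
      field_simp at hc
      exact hc
    · exfalso
      simp only [if_neg hP, AddChar.map_zero_eq_one] at key
      obtain ⟨x, hx⟩ := AddChar.ne_one_iff.mp hψ₀
      exact hx (key x)

omit [Fintype F] in
/-- **A relevant monomial matrix is `ι`-fixed**: if a Hecke function does not vanish at the monomial
`m`, then `ι(m) = m`. [folklore] -/
theorem iota_eq_self_of_apply_ne_zero (hψ₀ : ψ₀ ≠ 1) {f : GL (Fin n) F → ℂ}
    (hf : IsHeckeFunction (unitUpper F n) (thetaHom ψ₀ 1 (unitUpper F n) le_rfl) f)
    {m : GL (Fin n) F} {σ : Equiv.Perm (Fin n)} {d : Fin n → F}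
    (hm : ∀ i j, m.val i j = if i = σ j then d j else 0) (hfm : f m ≠ 0) : iota F n m = m := by
  -- `v = rev ∘ σ` satisfies the step condition
  set v : Equiv.Perm (Fin n) := σ.trans Fin.revPerm with hv
  have hvapply : ∀ j, v j = Fin.rev (σ j) := fun j => rfl
  have hsteps : ∀ (k : Fin n) (hk : k.val + 1 < n),
      v k < v ⟨k.val + 1, hk⟩ ∨ ((v k).val = (v ⟨k.val + 1, hk⟩).val + 1 ∧ d k = d ⟨k.val + 1, hk⟩) := by
    intro k hk
    rcases relevant_of_apply_ne_zero ψ₀ hψ₀ hf hm hfm k hk with h | ⟨h1, h2⟩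
    · left; rw [hvapply, hvapply]; exact Fin.rev_lt_rev.mpr h
    · right
      refine ⟨?_, h2⟩
      rw [hvapply, hvapply, Fin.val_rev, Fin.val_rev]
      have := (σ k).2
      omega
  have hinv := perm_involutive_of_steps v d hsteps
  apply Units.ext
  ext i j
  rw [coe_iota, iotaMatrix_apply, hm, hm]
  have hiff : Fin.rev j = σ (Fin.rev i) ↔ i = σ j := by
    constructor
    · intro h
      -- `j = v (rev i)`, so `v j = rev i`, i.e. `σ j = i`
      have h1 : j = v (Fin.rev i) := by rw [hvapply, ← h, Fin.rev_rev]
      have h2 := (hinv (Fin.rev i)).1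
      rw [← h1, hvapply] at h2
      have h3 := congrArg Fin.rev h2
      rw [Fin.rev_rev, Fin.rev_rev] at h3
      exact h3.symm
    · intro h
      have h1 : Fin.rev i = v j := by rw [hvapply, h]
      have h2 := (hinv j).1
      rw [← h1, hvapply] at h2
      have h3 := congrArg Fin.rev h2
      rw [Fin.rev_rev] at h3
      exact h3.symm
  by_cases h : i = σ j
  · rw [if_pos (hiff.mpr h), if_pos h]
    -- `d (rev i) = d (v j) = d j`
    have h1 : Fin.rev i = v j := by rw [hvapply, h]
    rw [h1, (hinv j).2]
  · rw [if_neg (fun h' => h (hiff.mp h')), if_neg h]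

omit [Fintype F] [DecidableEq F] in
/-- `ι` of a monomial matrix is monomial. [folklore] -/
theorem iota_monomial {m : GL (Fin n) F} {σ : Equiv.Perm (Fin n)} {d : Fin n → F}
    (hm : ∀ i j, m.val i j = if i = σ j then d j else 0) (i j : Fin n) :
    (iota F n m).val i j =
      if i = ((Fin.revPerm.trans σ.symm).trans Fin.revPerm) j then d (σ.symm (Fin.rev j)) else 0 := by
  rw [coe_iota, iotaMatrix_apply, hm]
  simp only [Equiv.trans_apply, Fin.revPerm_apply]
  have hiff : Fin.rev j = σ (Fin.rev i) ↔ i = Fin.rev (σ.symm (Fin.rev j)) := by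
    constructor
    · intro h; rw [h, Equiv.symm_apply_apply, Fin.rev_rev]
    · intro h; rw [h, Fin.rev_rev, Equiv.apply_symm_apply]
  by_cases h : Fin.rev j = σ (Fin.rev i)
  · rw [if_pos h, if_pos (hiff.mp h)]
    congr 1
    rw [h, Equiv.symm_apply_apply]
  · rw [if_neg h, if_neg (fun h' => h (hiff.mpr h'))]

omit [Fintype F] in
/-- **`f ∘ ι = f` for every `(U, ψ_U)`-Hecke function** (via Bruhat: `g = u₁⁻¹ m u₂⁻¹`, and
`f(ι m) = f(m)` for monomial `m`). [folklore] -/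
theorem apply_iota_eq (hψ₀ : ψ₀ ≠ 1) {f : GL (Fin n) F → ℂ}
    (hf : IsHeckeFunction (unitUpper F n) (thetaHom ψ₀ 1 (unitUpper F n) le_rfl) f) (g : GL (Fin n) F) :
    f (iota F n g) = f g := by
  -- monomial case
  have hmono : ∀ (m : GL (Fin n) F) (σ : Equiv.Perm (Fin n)) (d : Fin n → F),
      (∀ i j, m.val i j = if i = σ j then d j else 0) → f (iota F n m) = f m := by
    intro m σ d hm
    by_cases h1 : f m = 0
    · by_cases h2 : f (iota F n m) = 0
      · rw [h1, h2]
      · have := iota_eq_self_of_apply_ne_zero ψ₀ hψ₀ hf (iota_monomial hm) h2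
        rw [iota_iota] at this
        rw [← this]
    · rw [iota_eq_self_of_apply_ne_zero ψ₀ hψ₀ hf hm h1]
  obtain ⟨u₁, hu₁, u₂, hu₂, σ, d, hm⟩ := exists_bruhat g
  set m := u₁ * g * u₂ with hmdef
  have hg : g = u₁⁻¹ * m * u₂⁻¹ := by rw [hmdef]; group
  have hu₁i : u₁⁻¹ ∈ unitUpper F n := (unitUpper F n).inv_mem hu₁
  have hu₂i : u₂⁻¹ ∈ unitUpper F n := (unitUpper F n).inv_mem hu₂
  have e1 := (hf ⟨u₁⁻¹, hu₁i⟩ (m * u₂⁻¹)).1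
  have e2 := (hf ⟨u₂⁻¹, hu₂i⟩ m).2
  have e3 := (hf ⟨iota F n u₂⁻¹, iota_mem_unitUpper F n hu₂i⟩ (iota F n m * iota F n u₁⁻¹)).1
  have e4 := (hf ⟨iota F n u₁⁻¹, iota_mem_unitUpper F n hu₁i⟩ (iota F n m)).2
  simp only [coe_thetaHom_apply, theta_one_iota] at e1 e2 e3 e4
  rw [hg, iota_mul, iota_mul, show u₁⁻¹ * m * u₂⁻¹ = u₁⁻¹ * (m * u₂⁻¹) by group, e1, e2, e3, e4,
    hmono m σ d hm]
  ring

/-- **The Hecke algebra `ℋ(GL_n(𝔽_q), U, ψ_U)` is commutative** (Gelfand–Graev; Steinberg Thm. 49;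
Carter Thm. 8.1.3). [folklore] -/
theorem conv_comm_unitUpper (hψ₀ : ψ₀ ≠ 1) (f g : GL (Fin n) F → ℂ)
    (hf : IsHeckeFunction (unitUpper F n) (thetaHom ψ₀ 1 (unitUpper F n) le_rfl) f)
    (hg : IsHeckeFunction (unitUpper F n) (thetaHom ψ₀ 1 (unitUpper F n) le_rfl) g) :
    conv f g = conv g f :=
  conv_comm_of_antiInvolution (unitUpper F n) _ (iota F n) (iota_mul F n)
    (fun _ hf' => funext fun x => apply_iota_eq ψ₀ hψ₀ hf' x) (fun _ _ hf' hg' => hf'.conv hg') f g hf hg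

/-- **Uniqueness of Whittaker models for `GL_n(𝔽_q)`** (Gelfand–Graev): an irreducible
representation has at most a line of vectors `w` with `ρ(u) w = ψ_U(u) w` for all `u ∈ U_n`.
[folklore] -/
theorem finrank_whittaker_le_one (hψ₀ : ψ₀ ≠ 1) {W : Type} [AddCommGroup W] [Module ℂ W]
    [FiniteDimensional ℂ W] (ρ : Representation ℂ (GL (Fin n) F) W) (hρ : ρ.IsIrreducible) :
    finrank ℂ ↥(weightSpace ρ (unitUpper F n) (fun u => theta ψ₀ 1 (u : GL (Fin n) F))) ≤ 1 := by
  classical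
  haveI : Fintype (unitUpper F n) := Fintype.ofFinite _
  exact finrank_weightSpace_le_one_of_conv_comm (unitUpper F n) (thetaHom ψ₀ 1 (unitUpper F n) le_rfl) ρ
    (conv_comm_unitUpper ψ₀ hψ₀) hρ

/-- The same for the (equal) subgroup `tailGroup 1 = U_n` used in the Kirillov recursion. [folklore] -/
theorem finrank_whittaker_tailGroup_le_one (hψ₀ : ψ₀ ≠ 1) {W : Type} [AddCommGroup W] [Module ℂ W]
    [FiniteDimensional ℂ W] (ρ : Representation ℂ (GL (Fin n) F) W) (hρ : ρ.IsIrreducible) :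
    finrank ℂ ↥(weightSpace ρ (tailGroup F n 1) (fun u => theta ψ₀ 1 (u : GL (Fin n) F))) ≤ 1 := by
  have heq : weightSpace ρ (tailGroup F n 1) (fun u => theta ψ₀ 1 (u : GL (Fin n) F)) =
      weightSpace ρ (unitUpper F n) (fun u => theta ψ₀ 1 (u : GL (Fin n) F)) := by
    ext w
    simp only [mem_weightSpace]
    constructor
    · intro h u; exact h ⟨u, (mem_tailGroup_one_iff F n).mpr u.2⟩
    · intro h u; exact h ⟨u, (mem_tailGroup_one_iff F n).mp u.2⟩
  rw [heq]
  exact finrank_whittaker_le_one ψ₀ hψ₀ ρ hρ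

end Relevant

end Literature.RepresentationTheory.FiniteGroups.GLn

end
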